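import Mathlib.Analysis.Calculus.BumpFunction.Convolution
import Mathlib.Analysis.Calculus.BumpFunction.FiniteDimension
import Mathlib.Analysis.Calculus.ParametricIntegral
import Mathlib.MeasureTheory.Integral.Bochner.ContinuousLinearMap
import Mathlib.MeasureTheory.Measure.Haar.OfBasis
import HarnessLib

/-!
# Smoothing of `C¹`-bounded profiles with convergence of gradients (helper for `WindowLimit`)

Helper file for the route item `ParityLiouvilleSeed.WindowLimit` (`stmt-AtomisticToContinuum-13982`).
Bernardin's test class `C₀¹` for time invariance of the infinite chain consists of `C¹` profiles with
bounded values and bounded gradient, while weak steady states of the finite chain are tested on `C^∞`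
functions only. The gap is bridged by mollification on a finite-dimensional real normed space `E`:

* `bump_convolution_apply` — `(φ ⋆ g)(x) = ∫ φ(t) g(x - t) dt` for the normed bump `φ`;
* `abs_bump_convolution_le` — `|φ ⋆ g| ≤ sup |g|`;
* `hasFDerivAt_bump_convolution`, `norm_fderiv_bump_convolution_le`, `fderiv_bump_convolution_apply` —
  `D(φ ⋆ g) = φ ⋆ Dg` (differentiation under the integral sign, dominated by `φ · sup ‖Dg‖`), hence
  `‖D(φ ⋆ g)‖ ≤ sup ‖Dg‖` and `D(φ ⋆ g)(x) v = (φ ⋆ (Dg · v))(x)`;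
* `exists_smooth_approx_of_contDiff_one` — for `g ∈ C¹` with `|g| ≤ M`, `‖Dg‖ ≤ M'` there are smooth `g_j`
  with the SAME bounds, `g_j → g` and `Dg_j v → Dg v` pointwise (bumps of radius `1/(j+1)`,
  `ContDiffBump.convolution_tendsto_right_of_continuous`).

Nothing here closes an item.
-/

noncomputable section

namespace Summit.AtomisticToContinuum.FouriersLaw.Theorems.WindowLimit

open MeasureTheory Filter Topology Set Metric Function
open scoped Convolution ContDiff

variable {E : Type*} [NormedAddCommGroup E] [NormedSpace ℝ E] [FiniteDimensional ℝ E] [MeasurableSpace E]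
  [BorelSpace E]

section Bump

variable (μ : Measure E) [μ.IsAddHaarMeasure]

omit [BorelSpace E] [μ.IsAddHaarMeasure] in
/-- The convolution with a normed bump, written out: `(φ ⋆ g)(x) = ∫ φ(t) g(x - t) dt`. [folklore] -/
theorem bump_convolution_apply (φ : ContDiffBump (0 : E)) (g : E → ℝ) (x : E) :
    (φ.normed μ ⋆[ContinuousLinearMap.lsmul ℝ ℝ, μ] g) x = ∫ t, φ.normed μ t * g (x - t) ∂μ := by
  simp only [convolution_def, ContinuousLinearMap.lsmul_apply, smul_eq_mul]

/-- **`|φ ⋆ g| ≤ sup |g|`** for the normed bump (nonnegative, mass one). [folklore] -/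
theorem abs_bump_convolution_le (φ : ContDiffBump (0 : E)) {g : E → ℝ} {M : ℝ}
    (hM : ∀ y, |g y| ≤ M) (x : E) : |(φ.normed μ ⋆[ContinuousLinearMap.lsmul ℝ ℝ, μ] g) x| ≤ M := by
  rw [bump_convolution_apply]
  have hint : Integrable (fun t => φ.normed μ t * M) μ := φ.integrable_normed.mul_const M
  calc |∫ t, φ.normed μ t * g (x - t) ∂μ| ≤ ∫ t, φ.normed μ t * M ∂μ := by
        rw [← Real.norm_eq_abs]
        refine norm_integral_le_of_norm_le hint (Eventually.of_forall fun t => ?_)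
        rw [Real.norm_eq_abs, abs_mul, abs_of_nonneg (φ.nonneg_normed t)]
        exact mul_le_mul_of_nonneg_left (hM _) (φ.nonneg_normed t)
    _ = M := by rw [integral_mul_const, φ.integral_normed, one_mul]

/-- **Differentiation under the integral sign for the mollification of a `C¹` profile with bounded
gradient**: `D(φ ⋆ g)(x) = ∫ φ(t) Dg(x - t) dt`. [folklore] -/
theorem hasFDerivAt_bump_convolution (φ : ContDiffBump (0 : E)) {g : E → ℝ} (hg : ContDiff ℝ 1 g) {M' : ℝ}
    (hM' : ∀ y, ‖fderiv ℝ g y‖ ≤ M') (x₀ : E) :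
    HasFDerivAt (φ.normed μ ⋆[ContinuousLinearMap.lsmul ℝ ℝ, μ] g)
      (∫ t, φ.normed μ t • fderiv ℝ g (x₀ - t) ∂μ) x₀ := by
  have hgd : Differentiable ℝ g := hg.differentiable one_ne_zero
  have hgc : Continuous g := hg.continuous
  have hDc : Continuous (fderiv ℝ g) := hg.continuous_fderiv one_ne_zero
  have hφc : Continuous (φ.normed μ) := φ.continuous_normed
  have heq : (φ.normed μ ⋆[ContinuousLinearMap.lsmul ℝ ℝ, μ] g) = fun x => ∫ t, φ.normed μ t * g (x - t) ∂μ :=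
    funext fun x => bump_convolution_apply μ φ g x
  rw [heq]
  refine hasFDerivAt_integral_of_dominated_of_fderiv_le (F' := fun x t => φ.normed μ t • fderiv ℝ g (x - t))
    (bound := fun t => ‖φ.normed μ t‖ * M') (s := univ) univ_mem ?_ ?_ ?_ ?_ ?_ ?_
  · exact Eventually.of_forall fun x =>
      (hφc.mul (hgc.comp (continuous_const.sub continuous_id))).aestronglyMeasurable
  · exact ((hφc.mul (hgc.comp (continuous_const.sub continuous_id))).integrable_of_hasCompactSupport
      (φ.hasCompactSupport_normed.mul_right))
  · exact (hφc.smul (hDc.comp (continuous_const.sub continuous_id))).aestronglyMeasurable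
  · refine Eventually.of_forall fun t x _ => ?_
    rw [norm_smul]
    exact mul_le_mul_of_nonneg_left (hM' _) (norm_nonneg _)
  · exact φ.integrable_normed.norm.mul_const M'
  · refine Eventually.of_forall fun t x _ => ?_
    have h := ((hgd (x - t)).hasFDerivAt.comp x (hasFDerivAt_sub_const t)).const_mul (φ.normed μ t)
    refine h.congr_fderiv ?_
    rw [ContinuousLinearMap.comp_id]

/-- The integrand of `D(φ ⋆ g)` is integrable (continuous with compact support). [folklore] -/
theorem integrable_bump_smul_fderiv (φ : ContDiffBump (0 : E)) {g : E → ℝ} (hg : ContDiff ℝ 1 g) (x₀ : E) :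
    Integrable (fun t => φ.normed μ t • fderiv ℝ g (x₀ - t)) μ :=
  (φ.continuous_normed.smul ((hg.continuous_fderiv one_ne_zero).comp (continuous_const.sub continuous_id)))
    |>.integrable_of_hasCompactSupport φ.hasCompactSupport_normed.smul_right

/-- **`‖D(φ ⋆ g)‖ ≤ sup ‖Dg‖`**. [folklore] -/
theorem norm_fderiv_bump_convolution_le (φ : ContDiffBump (0 : E)) {g : E → ℝ} (hg : ContDiff ℝ 1 g) {M' : ℝ}
    (hM' : ∀ y, ‖fderiv ℝ g y‖ ≤ M') (x₀ : E) :
    ‖fderiv ℝ (φ.normed μ ⋆[ContinuousLinearMap.lsmul ℝ ℝ, μ] g) x₀‖ ≤ M' := by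
  rw [(hasFDerivAt_bump_convolution μ φ hg hM' x₀).fderiv]
  have hint : Integrable (fun t => ‖φ.normed μ t‖ * M') μ := φ.integrable_normed.norm.mul_const M'
  calc ‖∫ t, φ.normed μ t • fderiv ℝ g (x₀ - t) ∂μ‖ ≤ ∫ t, ‖φ.normed μ t‖ * M' ∂μ :=
        norm_integral_le_of_norm_le hint (Eventually.of_forall fun t => by
          rw [norm_smul]; exact mul_le_mul_of_nonneg_left (hM' _) (norm_nonneg _))
    _ = M' := by
        have e : (fun t => ‖φ.normed μ t‖ * M') = fun t => φ.normed μ t * M' := by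
          funext t; rw [Real.norm_eq_abs, abs_of_nonneg (φ.nonneg_normed t)]
        rw [e, integral_mul_const, φ.integral_normed, one_mul]

/-- **`D(φ ⋆ g)(x) v = (φ ⋆ (Dg · v))(x)`**: the directional derivative of the mollification is the
mollification of the directional derivative. [folklore] -/
theorem fderiv_bump_convolution_apply (φ : ContDiffBump (0 : E)) {g : E → ℝ} (hg : ContDiff ℝ 1 g) {M' : ℝ}
    (hM' : ∀ y, ‖fderiv ℝ g y‖ ≤ M') (x₀ v : E) :
    fderiv ℝ (φ.normed μ ⋆[ContinuousLinearMap.lsmul ℝ ℝ, μ] g) x₀ v =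
      (φ.normed μ ⋆[ContinuousLinearMap.lsmul ℝ ℝ, μ] (fun y => fderiv ℝ g y v)) x₀ := by
  rw [(hasFDerivAt_bump_convolution μ φ hg hM' x₀).fderiv,
    ContinuousLinearMap.integral_apply (integrable_bump_smul_fderiv μ φ hg x₀) v, bump_convolution_apply]
  congr 1

end Bump

/-- **Smoothing of `C¹`-bounded profiles with pointwise convergence of values and gradients.** For
`g ∈ C¹(E)` on a finite-dimensional real normed space with `|g| ≤ M` and `‖Dg‖ ≤ M'`, there are smooth
functions `g_j` with the same two bounds such that `g_j(y) → g(y)` and `Dg_j(y) v → Dg(y) v` for all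
`y, v` (mollification with normed bumps of radius `→ 0`). [folklore] -/
theorem exists_smooth_approx_of_contDiff_one {g : E → ℝ} (hg : ContDiff ℝ 1 g) {M M' : ℝ}
    (hM : ∀ y, |g y| ≤ M) (hM' : ∀ y, ‖fderiv ℝ g y‖ ≤ M') :
    ∃ gs : ℕ → E → ℝ, (∀ j, ContDiff ℝ ∞ (gs j)) ∧ (∀ j y, |gs j y| ≤ M) ∧
      (∀ j y, ‖fderiv ℝ (gs j) y‖ ≤ M') ∧ (∀ y, Tendsto (fun j => gs j y) atTop (𝓝 (g y))) ∧
        (∀ y v, Tendsto (fun j => fderiv ℝ (gs j) y v) atTop (𝓝 (fderiv ℝ g y v))) := by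
  set μ : Measure E := Measure.addHaar with hμ
  have hgc : Continuous g := hg.continuous
  have hDc : ∀ v : E, Continuous fun y => fderiv ℝ g y v := fun v =>
    (hg.continuous_fderiv one_ne_zero).clm_apply continuous_const
  -- bumps of outer radius `1/(j+1)`
  have hr : ∀ j : ℕ, (1 : ℝ) / ((j : ℝ) + 2) < 1 / ((j : ℝ) + 1) := fun j =>
    one_div_lt_one_div_of_lt (by positivity) (by linarith)
  set φ : ℕ → ContDiffBump (0 : E) := fun j => ⟨1 / ((j : ℝ) + 2), 1 / ((j : ℝ) + 1), by positivity, hr j⟩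
    with hφ
  have hφout : Tendsto (fun j => (φ j).rOut) atTop (𝓝 0) := by
    have : (fun j => (φ j).rOut) = fun j : ℕ => 1 / ((j : ℝ) + 1) := rfl
    rw [this]
    exact tendsto_one_div_add_atTop_nhds_zero_nat
  refine ⟨fun j => (φ j).normed μ ⋆[ContinuousLinearMap.lsmul ℝ ℝ, μ] g, fun j => ?_, fun j y => ?_,
    fun j y => ?_, fun y => ?_, fun y v => ?_⟩
  · exact (φ j).hasCompactSupport_normed.contDiff_convolution_left _ (φ j).contDiff_normed
      hgc.locallyIntegrable
  · exact abs_bump_convolution_le μ (φ j) hM y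
  · exact norm_fderiv_bump_convolution_le μ (φ j) hg hM' y
  · exact ContDiffBump.convolution_tendsto_right_of_continuous hφout hgc y
  · have e : (fun j => fderiv ℝ ((φ j).normed μ ⋆[ContinuousLinearMap.lsmul ℝ ℝ, μ] g) y v) =
        fun j => ((φ j).normed μ ⋆[ContinuousLinearMap.lsmul ℝ ℝ, μ] (fun y => fderiv ℝ g y v)) y :=
      funext fun j => fderiv_bump_convolution_apply μ (φ j) hg hM' y v
    rw [e]
    exact ContDiffBump.convolution_tendsto_right_of_continuous hφout (hDc v) y

end Summit.AtomisticToContinuum.FouriersLaw.Theorems.WindowLimit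

end
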